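import Summits.NavierStokesRegularity.NavierStokesRegularity.Theorems.HardyPointSinkNoHardyTypeIAncientSmallTypeI

/-!
# Route HardyPointSink — crux `NoHardyTypeIAncient` (stmt-NavierStokesRegularity-7980), line `birth` /
# `registered`: the LARGE-SCALE ε-gap certificate (entry point of the blow-down lines)

Summit-side proof file (lead c6; certificate sub-goal `hardyPointSink_cert_largeScale` of the registered
skeleton `Cruxes/NoHardyTypeIAncient/Lines/birth.lean`). The ε-gap certificate of lead c4
(`hardyPointSink_cert_smallTypeI`, this file's import) excludes witnesses whose Albritton–Barker quantity
`𝐈 = sup_Q (A + C + D + E)` is small over ALL parabolic balls. Here the same one-scale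
Caffarelli–Kohn–Nirenberg criterion is spent only at LARGE balls about ONE spatial centre:

**Theorem (`hardyPointSink_cert_largeScale`).** There is a universal `ε > 0` such that every suitable weak
solution `(u, p)` of Navier–Stokes (`ν = 1`, no force) on the slab `(−∞, 0) × ℝ³`, with weak spatial
gradient `G` and `𝐈(ℝ³ × ℝ₋) < ∞`, for which at some centre `x₁` and every final time `t₁ < 0` the
one-scale quantity `C(Q((t₁, x₁), c)) + D_osc(Q((t₁, x₁), c))` dips below `ε` along arbitrarily large
radii `c`, vanishes a.e. on the slab.

Equivalently (`hardyPointSink_cert_largeScale_witness`, `…_abScaledSum`): a NON-ZERO Type-I solution — in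
particular every hypothetical witness of the crux — is `ε`-singular at spatial infinity about every centre:
for some `t₁ < 0`, `C + D_osc ≥ ε` on `Q((t₁, x₁), c)` for all large `c`. This is the limit-free form
of "every blow-down `λ_k u(λ_k ·, λ_k² ·)`, `λ_k → ∞`, of a witness is non-trivial", the first step of
the crux ideas `blowdown-cone` (S1) and `exposed-halfspace` (G3) on file in the crux directory; no
mildness and no Hardy bound is used, so it serves stmt-NavierStokesRegularity-1749 (L′) verbatim as well.

Proof. With `ε = ε₀³` (`ε₀, C₀` from `Seregin2020.exists_epsilonRegularity_top`, CKN 1982 Prop. 1 at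
top-touching cylinders): for `t₁ = −1/(n+1)` pick a radius `c_n ≥ n + 1` at which the quantity is `< ε`
(frequently along `c → ∞`). The Navier–Stokes zoom `v = c_n u(t₁ + c_n² s, x₁ + c_n y)` with mean-free
pressure is suitable in `Q(0, 1)` with `A, E, D` finite (`hardyPointSink_smallTypeI_zoom`), and by exact
scale covariance (`cknC_nsZoom`, `cknDOsc_nsZoom`) its one-scale quantity `C(Q(0,1); v) + D(Q(0,1); q)`
IS `C + D_osc` of `(u, p)` on `Q((t₁, x₁), c_n)`, hence `< ε₀³`; the criterion gives `|v| ≤ C₀ ε₀` a.e.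
on `Q(0, 1/2)`, i.e. `c_n |u| ≤ C₀ ε₀` a.e. on `Q((t₁, x₁), c_n/2)` (`hardyPointSink_smallTypeI_unzoom`).
These cylinders exhaust the slab and `c_n → ∞` forces `u = 0` a.e.
(`hardyPointSink_largeScale_ae_eq_zero`).

## References

* L. Caffarelli, R. Kohn, L. Nirenberg, CPAM 35 (1982), Prop. 1. [CaffarelliKohnNirenberg1982]
* G. Seregin, Anal. Math. Phys. 10 (2020), Paper 46 = arXiv:2006.04140, Prop. 1.4 (1). [Seregin2020]
* D. Albritton, T. Barker, J. Math. Fluid Mech. 21 (2019) = arXiv:1811.00502, §1 (𝐈), §3–§4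
  (zooming out; Thm 4.1 / Remark 4.3: blow-down + backward uniqueness). [AlbrittonBarker2019]
-/

noncomputable section

set_option linter.dupNamespace false

open MeasureTheory Set Function Filter TopologicalSpace Metric
open scoped ENNReal NNReal Topology

namespace Summit.NavierStokesRegularity.NavierStokesRegularity.Theorems

open Literature.Analysis.FluidPDE

/-- **Exhaustion along chosen large scales.** If for every `n` there is a radius `c n ≥ n + 1` with
`c n · |u| ≤ K` a.e. on the parabolic cylinder `Q((−1/(n+1), x₁), c n / 2)`, then `u = 0` a.e. on
`(−∞, 0) × ℝ³`: every point of the slab lies in all but finitely many of these cylinders, and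
`c n · a ≤ K` with `c n ≥ n + 1 → ∞` forces `a = 0`. (The version of
`hardyPointSink_smallTypeI_ae_eq_zero` with an arbitrary spatial centre and arbitrary radii
`c n ≥ n + 1`.) [folklore] -/
theorem hardyPointSink_largeScale_ae_eq_zero
    {u : ℝ → EuclideanSpace ℝ (Fin 3) → EuclideanSpace ℝ (Fin 3)} (x₁ : EuclideanSpace ℝ (Fin 3))
    (c : ℕ → ℝ) (hc : ∀ n : ℕ, (n : ℝ) + 1 ≤ c n) {K : ℝ}
    (h : ∀ n : ℕ, ∀ᵐ z ∂(volume.restrict (parabolicCylinder (c n / 2)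
      (-(1 / ((n : ℝ) + 1)), x₁))), c n * ‖uncurry u z‖ ≤ K) :
    uncurry u =ᵐ[volume.restrict (Iio (0 : ℝ) ×ˢ (univ : Set (EuclideanSpace ℝ (Fin 3))))] 0 := by
  -- gather the countably many a.e. statements into one
  have h' : ∀ᵐ z ∂(volume : Measure (ℝ × EuclideanSpace ℝ (Fin 3))), ∀ n : ℕ,
      z ∈ parabolicCylinder (c n / 2) (-(1 / ((n : ℝ) + 1)), x₁) →
        c n * ‖uncurry u z‖ ≤ K := by
    rw [ae_all_iff]
    intro n
    exact (ae_restrict_iff' (isOpen_parabolicCylinder _ _).measurableSet).1 (h n)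
  rw [EventuallyEq, ae_restrict_iff' (measurableSet_Iio.prod MeasurableSet.univ)]
  filter_upwards [h'] with z hz hzmem
  have hz1 : z.1 < 0 := hzmem.1
  rw [Pi.zero_apply]
  by_contra hne
  have ha : 0 < ‖uncurry u z‖ := norm_pos_iff.2 hne
  -- choose `n` so large that `z` lies in the `n`-th cylinder and `c n · |u z| > K`
  have ev := tendsto_natCast_atTop_atTop (R := ℝ)
  have evt : ∀ᶠ n : ℕ in atTop, 1 / ((n : ℝ) + 1) < -z.1 :=
    (tendsto_one_div_add_atTop_nhds_zero_nat (𝕜 := ℝ)).eventually_lt_const (neg_pos.2 hz1)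
  obtain ⟨n, hn1, hn2, hn3, hn4⟩ : ∃ n : ℕ, -4 * z.1 < n ∧ 1 / ((n : ℝ) + 1) < -z.1 ∧
      2 * dist z.2 x₁ < n ∧ K / ‖uncurry u z‖ < n := by
    obtain ⟨n, h1, h2, h3, h4⟩ := ((ev.eventually_gt_atTop (-4 * z.1)).and (evt.and
      ((ev.eventually_gt_atTop (2 * dist z.2 x₁)).and
        (ev.eventually_gt_atTop (K / ‖uncurry u z‖))))).exists
    exact ⟨n, h1, h2, h3, h4⟩
  have hn0 : (0 : ℝ) ≤ n := Nat.cast_nonneg n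
  have hcn : (n : ℝ) + 1 ≤ c n := hc n
  have hcn1 : (1 : ℝ) ≤ c n := le_trans (by linarith) hcn
  have hmem : z ∈ parabolicCylinder (c n / 2) (-(1 / ((n : ℝ) + 1)), x₁) := by
    rw [mem_parabolicCylinder]
    refine ⟨⟨?_, ?_⟩, ?_⟩
    · show -(1 / ((n : ℝ) + 1)) - (c n / 2) ^ 2 < z.1
      have hq : 0 < 1 / ((n : ℝ) + 1) := by positivity
      -- `(c n / 2)² ≥ c n / 4 · 1 ≥ (n + 1)/4 > -z.1`
      have h1 : (n : ℝ) + 1 ≤ (c n / 2) ^ 2 * 4 := by nlinarith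
      nlinarith
    · show z.1 < -(1 / ((n : ℝ) + 1))
      linarith
    · show dist z.2 x₁ < c n / 2
      linarith
  have hb := hz n hmem
  have hK : K < (n : ℝ) * ‖uncurry u z‖ := (div_lt_iff₀ ha).1 hn4
  have hK' : (n : ℝ) * ‖uncurry u z‖ ≤ c n * ‖uncurry u z‖ :=
    mul_le_mul_of_nonneg_right (by linarith) ha.le
  linarith

/-- The affine zoom `Φ(s, y) = (t₁ + c² s, x₁ + c y)` maps the origin to the centre `(t₁, x₁)`.
[folklore] -/
theorem hardyPointSink_largeScale_stAffine_zero (c t₁ : ℝ) (x₁ : EuclideanSpace ℝ (Fin 3)) :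
    stAffine (c ^ 2) c t₁ x₁ (0 : ℝ × EuclideanSpace ℝ (Fin 3)) = (t₁, x₁) := by
  simp [stAffine]

/-- **Exact scale covariance of the one-scale quantity.** For the Navier–Stokes zoom
`v = c u ∘ Φ`, `q = c² p ∘ Φ` normalised to mean zero on `B(0, 1)`, `Φ(s, y) = (t₁ + c² s, x₁ + c y)`:
`C(Q(0,1); v) + D(Q(0,1); q) = C(Q((t₁,x₁), c); u) + D_osc(Q((t₁,x₁), c); p)` — the plain pressure
quantity of the normalised zoomed pressure is the mean-free one (`hardyPointSink_smallTypeI_cknD_sub_average`)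
and both `C` and `D_osc` are invariant (`cknC_nsZoom`, `cknDOsc_nsZoom`). [folklore] -/
theorem hardyPointSink_largeScale_oneScale_eq
    (u : ℝ → EuclideanSpace ℝ (Fin 3) → EuclideanSpace ℝ (Fin 3))
    (p : ℝ → EuclideanSpace ℝ (Fin 3) → ℝ) {c : ℝ} (hc : 0 < c) (t₁ : ℝ)
    (x₁ : EuclideanSpace ℝ (Fin 3)) :
    cknC 1 (0 : ℝ × EuclideanSpace ℝ (Fin 3)) (c • stPull (c ^ 2) c t₁ x₁ u) +
        cknD 1 (0 : ℝ × EuclideanSpace ℝ (Fin 3))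
          (fun t x => (c ^ 2 • stPull (c ^ 2) c t₁ x₁ p) t x -
            ⨍ y in ball (0 : EuclideanSpace ℝ (Fin 3)) 1, (c ^ 2 • stPull (c ^ 2) c t₁ x₁ p) t y) =
      cknC c (t₁, x₁) u + cknDOsc c (t₁, x₁) p := by
  rw [hardyPointSink_smallTypeI_cknD_sub_average, cknC_nsZoom hc one_pos, cknDOsc_nsZoom hc one_pos,
    mul_one, hardyPointSink_largeScale_stAffine_zero]

/-- **Certificate `hardyPointSink_cert_largeScale` (the large-scale `ε`-gap).** There is a universal
`ε > 0` such that every suitable weak solution `(u, p)` of Navier–Stokes (`ν = 1`, no force) on the slab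
`(−∞, 0) × ℝ³` with weak spatial gradient `G` and `𝐈(ℝ³ × ℝ₋) = typeIBound (Iio 0 ×ˢ univ) u p G < ∞`,
such that at some spatial centre `x₁` and EVERY final time `t₁ < 0` the one-scale quantity
`C(Q((t₁,x₁),c)) + D_osc(Q((t₁,x₁),c))` is `< ε` for arbitrarily large radii `c` (frequently along
`c → ∞`), is a.e. zero on the slab: at such a radius `c ≥ n + 1` (with `t₁ = −1/(n+1)`) the zoom
`c u(t₁ + c² s, x₁ + c y)` is suitable in `Q(0, 1)` with mean-free pressure and finite `A, E, D`
(`hardyPointSink_smallTypeI_zoom`), its one-scale quantity equals the large-scale one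
(`hardyPointSink_largeScale_oneScale_eq`), so the one-scale CKN criterion (Seregin 2020 Prop. 1.4 (1),
tree theorem `Seregin2020.exists_epsilonRegularity_top`, `ε = ε₀³`) gives `c |u| ≤ C₀ ε₀` a.e. on
`Q((t₁,x₁), c/2)`; the cylinders exhaust the slab (`hardyPointSink_largeScale_ae_eq_zero`). No mildness,
no boundedness, no Hardy bound is used. [cite: Seregin2020, Prop. 1.4 (1)] -/
theorem hardyPointSink_cert_largeScale :
    ∃ ε : ℝ≥0∞, 0 < ε ∧
    ∀ (u : ℝ → EuclideanSpace ℝ (Fin 3) → EuclideanSpace ℝ (Fin 3))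
      (p : ℝ → EuclideanSpace ℝ (Fin 3) → ℝ)
      (G : ℝ → EuclideanSpace ℝ (Fin 3) → EuclideanSpace ℝ (Fin 3) →L[ℝ] EuclideanSpace ℝ (Fin 3)),
      Literature.Analysis.FluidPDE.IsSuitableWeakSolutionOn
        (Literature.Analysis.FluidPDE.slab (EuclideanSpace ℝ (Fin 3)) (Iio 0) isOpen_Iio) 1 0 u p →
      Literature.Analysis.FluidPDE.HasWeakSpatialGradientOn
        (Literature.Analysis.FluidPDE.slab (EuclideanSpace ℝ (Fin 3)) (Iio 0) isOpen_Iio) u G →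
      Literature.Analysis.FluidPDE.typeIBound
        (Iio (0 : ℝ) ×ˢ (univ : Set (EuclideanSpace ℝ (Fin 3)))) u p G < ⊤ →
      ∀ x₁ : EuclideanSpace ℝ (Fin 3),
        (∀ t₁ : ℝ, t₁ < 0 → ∃ᶠ c in atTop,
          Literature.Analysis.FluidPDE.cknC c (t₁, x₁) u +
            Literature.Analysis.FluidPDE.cknDOsc c (t₁, x₁) p < ε) →
      uncurry u =ᵐ[volume.restrict (Iio (0 : ℝ) ×ˢ (univ : Set (EuclideanSpace ℝ (Fin 3))))] 0 := by
  obtain ⟨ε₀, C₀, hε₀, -, H⟩ := Seregin2020.exists_epsilonRegularity_top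
  refine ⟨ENNReal.ofReal (ε₀ ^ 3), ENNReal.ofReal_pos.2 (pow_pos hε₀ 3),
    fun u p G hsw hwg hI x₁ hfreq => ?_⟩
  -- choose radii `c n ≥ n + 1` with smallness at the final time `t₁ = -1/(n+1)`
  have hchoice : ∀ n : ℕ, ∃ c : ℝ, (n : ℝ) + 1 ≤ c ∧
      cknC c (-(1 / ((n : ℝ) + 1)), x₁) u + cknDOsc c (-(1 / ((n : ℝ) + 1)), x₁) p <
        ENNReal.ofReal (ε₀ ^ 3) := by
    intro n
    have ht₁ : -(1 / ((n : ℝ) + 1)) < 0 := neg_neg_of_pos (by positivity)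
    obtain ⟨c, hc, hsmall⟩ := (hfreq _ ht₁).forall_exists_of_atTop ((n : ℝ) + 1)
    exact ⟨c, hc, hsmall⟩
  choose c hc hsmall using hchoice
  refine hardyPointSink_largeScale_ae_eq_zero x₁ c hc (K := C₀ * ε₀) fun n => ?_
  have hcpos : 0 < c n := lt_of_lt_of_le (by positivity) (hc n)
  have ht₁ : -(1 / ((n : ℝ) + 1)) < 0 := neg_neg_of_pos (by positivity)
  obtain ⟨hsuitQ, hwgQ, hA, hE, hD, -⟩ :=
    hardyPointSink_smallTypeI_zoom hsw hwg hI.ne_top hcpos ht₁ x₁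
  have hCD := hardyPointSink_largeScale_oneScale_eq u p hcpos (-(1 / ((n : ℝ) + 1))) x₁
  have hreg := H _ _ _ _ hsuitQ hwgQ 0 1 one_pos (fun _ hw => hw) hA hE hD 1 ε₀ one_pos le_rfl
    hε₀.le le_rfl (by rw [hCD]; exact (hsmall n).le)
  rw [div_one] at hreg
  exact hardyPointSink_smallTypeI_unzoom hcpos _ _ hreg

/-- `C + D_osc ≤ A + C + D_osc + E` for every parabolic ball. [folklore] -/
theorem hardyPointSink_largeScale_cknC_add_cknDOsc_le_abScaledSum (r : ℝ)
    (z : ℝ × EuclideanSpace ℝ (Fin 3))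
    (u : ℝ → EuclideanSpace ℝ (Fin 3) → EuclideanSpace ℝ (Fin 3))
    (p : ℝ → EuclideanSpace ℝ (Fin 3) → ℝ)
    (G : ℝ → EuclideanSpace ℝ (Fin 3) → EuclideanSpace ℝ (Fin 3) →L[ℝ] EuclideanSpace ℝ (Fin 3)) :
    cknC r z u + cknDOsc r z p ≤ abScaledSum r z u p G := by
  unfold abScaledSum
  exact (add_le_add (le_add_self : cknC r z u ≤ cknAEss r z u + cknC r z u)
    (le_refl (cknDOsc r z p))).trans le_self_add

/-- **Witness form: a non-zero Type-I solution is `ε`-singular at spatial infinity.** With the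
universal `ε` of `hardyPointSink_cert_largeScale`: if `(u, p, G)` is suitable on the slab with
`𝐈 < ∞` and `u` is NOT a.e. zero, then about every spatial centre `x₁` there is a final time
`t₁ < 0` such that `C(Q((t₁,x₁),c)) + D_osc(Q((t₁,x₁),c)) ≥ ε` for all sufficiently large radii `c`
(contrapositive of the certificate: `¬ ∃ᶠ small ↔ ∀ᶠ large`). In particular every hypothetical
witness of the crux `NoHardyTypeIAncient` — and of stmt-1749 (L′) — has non-trivial blow-downs.
[cite: Seregin2020, Prop. 1.4 (1)] -/
theorem hardyPointSink_cert_largeScale_witness :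
    ∃ ε : ℝ≥0∞, 0 < ε ∧
    ∀ (u : ℝ → EuclideanSpace ℝ (Fin 3) → EuclideanSpace ℝ (Fin 3))
      (p : ℝ → EuclideanSpace ℝ (Fin 3) → ℝ)
      (G : ℝ → EuclideanSpace ℝ (Fin 3) → EuclideanSpace ℝ (Fin 3) →L[ℝ] EuclideanSpace ℝ (Fin 3)),
      Literature.Analysis.FluidPDE.IsSuitableWeakSolutionOn
        (Literature.Analysis.FluidPDE.slab (EuclideanSpace ℝ (Fin 3)) (Iio 0) isOpen_Iio) 1 0 u p →
      Literature.Analysis.FluidPDE.HasWeakSpatialGradientOn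
        (Literature.Analysis.FluidPDE.slab (EuclideanSpace ℝ (Fin 3)) (Iio 0) isOpen_Iio) u G →
      ¬ (uncurry u =ᵐ[volume.restrict
        (Iio (0 : ℝ) ×ˢ (univ : Set (EuclideanSpace ℝ (Fin 3))))] 0) →
      Literature.Analysis.FluidPDE.typeIBound
        (Iio (0 : ℝ) ×ˢ (univ : Set (EuclideanSpace ℝ (Fin 3)))) u p G < ⊤ →
      ∀ x₁ : EuclideanSpace ℝ (Fin 3), ∃ t₁ : ℝ, t₁ < 0 ∧ ∀ᶠ c in atTop,
        ε ≤ Literature.Analysis.FluidPDE.cknC c (t₁, x₁) u +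
          Literature.Analysis.FluidPDE.cknDOsc c (t₁, x₁) p := by
  obtain ⟨ε, hε, h⟩ := hardyPointSink_cert_largeScale
  refine ⟨ε, hε, fun u p G hsw hwg hne hI x₁ => ?_⟩
  by_contra hcon
  push Not at hcon
  exact hne (h u p G hsw hwg hI x₁ fun t₁ ht₁ => hcon t₁ ht₁)

/-- **Witness form for the full Albritton–Barker quantity**: under the same hypotheses,
`(A + C + D_osc + E)(Q((t₁,x₁),c)) ≥ ε` for all large `c` — the Type-I quantity restricted to large
balls about any centre does not become small: every blow-down sequence of a witness stays
`ε`-far from zero in the one-scale CKN quantity. [cite: Seregin2020, Prop. 1.4 (1)] -/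
theorem hardyPointSink_cert_largeScale_abScaledSum :
    ∃ ε : ℝ≥0∞, 0 < ε ∧
    ∀ (u : ℝ → EuclideanSpace ℝ (Fin 3) → EuclideanSpace ℝ (Fin 3))
      (p : ℝ → EuclideanSpace ℝ (Fin 3) → ℝ)
      (G : ℝ → EuclideanSpace ℝ (Fin 3) → EuclideanSpace ℝ (Fin 3) →L[ℝ] EuclideanSpace ℝ (Fin 3)),
      Literature.Analysis.FluidPDE.IsSuitableWeakSolutionOn
        (Literature.Analysis.FluidPDE.slab (EuclideanSpace ℝ (Fin 3)) (Iio 0) isOpen_Iio) 1 0 u p →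
      Literature.Analysis.FluidPDE.HasWeakSpatialGradientOn
        (Literature.Analysis.FluidPDE.slab (EuclideanSpace ℝ (Fin 3)) (Iio 0) isOpen_Iio) u G →
      ¬ (uncurry u =ᵐ[volume.restrict
        (Iio (0 : ℝ) ×ˢ (univ : Set (EuclideanSpace ℝ (Fin 3))))] 0) →
      Literature.Analysis.FluidPDE.typeIBound
        (Iio (0 : ℝ) ×ˢ (univ : Set (EuclideanSpace ℝ (Fin 3)))) u p G < ⊤ →
      ∀ x₁ : EuclideanSpace ℝ (Fin 3), ∃ t₁ : ℝ, t₁ < 0 ∧ ∀ᶠ c in atTop,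
        ε ≤ Literature.Analysis.FluidPDE.abScaledSum c (t₁, x₁) u p G := by
  obtain ⟨ε, hε, h⟩ := hardyPointSink_cert_largeScale_witness
  refine ⟨ε, hε, fun u p G hsw hwg hne hI x₁ => ?_⟩
  obtain ⟨t₁, ht₁, hev⟩ := h u p G hsw hwg hne hI x₁
  exact ⟨t₁, ht₁, hev.mono fun c hc =>
    hc.trans (hardyPointSink_largeScale_cknC_add_cknDOsc_le_abScaledSum c (t₁, x₁) u p G)⟩

/-- **No witness of the crux is quiet at large scales** (corollary on the crux class, for the
skeleton's `noWitness_*` census): a triple `(u, p, G)` of the class of `NoHardyTypeIAncient` —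
here only suitability, the weak gradient, non-triviality and `𝐈 < ∞` are used — for which
`C + D_osc` on `Q((t₁, x₁), c)` is `< ε` frequently as `c → ∞` at every `t₁ < 0` (some centre `x₁`)
does not exist. [cite: Seregin2020, Prop. 1.4 (1)] -/
theorem hardyPointSink_noHardyTypeIAncient_largeScaleQuiet :
    ∃ ε : ℝ≥0∞, 0 < ε ∧
    ∀ (u : ℝ → EuclideanSpace ℝ (Fin 3) → EuclideanSpace ℝ (Fin 3))
      (p : ℝ → EuclideanSpace ℝ (Fin 3) → ℝ)
      (G : ℝ → EuclideanSpace ℝ (Fin 3) → EuclideanSpace ℝ (Fin 3) →L[ℝ] EuclideanSpace ℝ (Fin 3)),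
      Literature.Analysis.FluidPDE.IsSuitableWeakSolutionOn
        (Literature.Analysis.FluidPDE.slab (EuclideanSpace ℝ (Fin 3)) (Iio 0) isOpen_Iio) 1 0 u p →
      Literature.Analysis.FluidPDE.HasWeakSpatialGradientOn
        (Literature.Analysis.FluidPDE.slab (EuclideanSpace ℝ (Fin 3)) (Iio 0) isOpen_Iio) u G →
      ¬ (uncurry u =ᵐ[volume.restrict
        (Iio (0 : ℝ) ×ˢ (univ : Set (EuclideanSpace ℝ (Fin 3))))] 0) →
      Literature.Analysis.FluidPDE.typeIBound
        (Iio (0 : ℝ) ×ˢ (univ : Set (EuclideanSpace ℝ (Fin 3)))) u p G < ⊤ →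
      ∀ x₁ : EuclideanSpace ℝ (Fin 3),
        (∀ t₁ : ℝ, t₁ < 0 → ∃ᶠ c in atTop,
          Literature.Analysis.FluidPDE.cknC c (t₁, x₁) u +
            Literature.Analysis.FluidPDE.cknDOsc c (t₁, x₁) p < ε) → False := by
  obtain ⟨ε, hε, h⟩ := hardyPointSink_cert_largeScale
  exact ⟨ε, hε, fun u p G hsw hwg hne hI x₁ hq => hne (h u p G hsw hwg hI x₁ hq)⟩

end Summit.NavierStokesRegularity.NavierStokesRegularity.Theorems

end
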